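import Summits.QuantumFields.YangMills.Theorems.BalabanUVNodesN15KingModelBlockCovarianceContinuumForm

/-!
# BalabanUVNodes ∕ N15 — THE KING-MODEL RUNG (PART Ϡ-g): THE `K → ∞` LIMIT OF KING's EFFECTIVE LAPLACIAN ITSELF — `Δ^{(K)}(b, b′) = |Ω|⁻¹Σ_q Δ^{(K)}(p′(q))
# Re e^{iq·(b′−b)} → Δ^{(∞)}(b, b′) := |Ω|⁻¹Σ_q Δ^{(∞)}(p′(q)) Re e^{iq·(b′−b)}` IN CLOSED FORM, AND `Δ^{(∞)}·C^{(∞)} = 1`: THE CONTINUUM UNIT-LATTICE EFFECTIVE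
# LAPLACIAN IS THE INVERSE OF THE CONTINUUM BLOCK COVARIANCE, UNIFORMLY COERCIVE
# (Track A, DAG node N15 = NE2; FAN-OUT v1.1 §N15 s3 «KING-MODEL RUNG … NE2's analogue DECIDED in the model»)

HONEST FRAMING.  Count-neutral (cell `pub-ymgap`, seat `pub-ymgap-dag-n15-e` g32; `--supports stmt-QuantumFields-27366 --as helper` = K3⁸
`SpineGivenEndpointR13SepCoPHV`).  TEMPLATE LITERATURE: C. King, *The U(1) Higgs model. I. The continuum limit*, Commun. Math. Phys. **102** (1986) 649–677
[King1986] — KING's OWN `A = 0` MODEL on the unit torus `Ω = Tor M`: the effective Laplacian `Δ^{(k)} = a_k − a_k²Q_kG_kQ_k^*` ((2.14) p. 653; tree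
`Torus.effLaplacian`, its plane-wave form (4.35) with symbol (4.5) `effLaplacian_form`∕`effSym`, symmetry `effLaplacian_symm`, invertibility
`effLaplacian_isUnit`), the free-field effective action `S^{(k),1}(ψ) = ½⟨ψ, Δ^{(k)}ψ⟩ + const` (p. 657; the rung's `kingFreeS`, parts Τ-e∕Τ-i), and Thm 3.4's
convergence «two models on the same unit lattice» (3.9) p. 656 in the model.  NOT Bałaban's `Δ^{(k)}(U)`; NOT a node discharge (N15 is booked through n15-a's knit,
untouched here); nothing continuum-Yang–Mills ∕ ℝ⁴ ∕ OS ∕ mass-gap ∕ Clay.  0 `sorry`; standard axioms; ONE plumbing `def` (`effLaplacianLim`, the explicit limit).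

THE MATHEMATICS.  Polarizing the tree's (4.35)∕(4.5) form `|Ω|⟨φ, Δ^{(K)}φ⟩ = Σ_q Δ^{(K)}(p′(q))|φ̃(q)|²` (part Ϡ-d's `polarization_entry`; `Δ^{(K)}` is symmetric)
gives the ENTRIES `Δ^{(K)}(b, b′) = |Ω|⁻¹Σ_q effSym_K(q)·Re e^{iq·(b′−b)}` exactly (§1); part Ϡ-c's `effSym_K(q) → Δ^{(∞)}(p′(q)) = a_∞∕(1 + a_∞S_∞(p′(q)))` then gives
`Δ^{(K)}(b, b′) → Δ^{(∞)}(b, b′)` with `Δ^{(∞)}` THE EXPLICIT FUNCTION `effLaplacianLim` (§2).  The finite matrix identity `Δ^{(K)}·(Δ^{(K)})⁻¹ = 1` passes to the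
limit entrywise (finite sums of products of convergent sequences), so `Δ^{(∞)}·C^{(∞)} = 1 = C^{(∞)}·Δ^{(∞)}` and `C^{(∞)} = (Δ^{(∞)})⁻¹` (§3): the limit of NE2's unit
layer IS the covariance of the Gaussian with King's continuum unit-lattice action `½⟨ψ, Δ^{(∞)}ψ⟩` — the `K → ∞` limit of the free-field effective actions of Thm 3.4
in closed form.  The form of `Δ^{(∞)}` is `|Ω|⁻¹Σ_q Δ^{(∞)}(p′(q))|φ̃(q)|²` with `a_∞∕(1 + a_∞B) ≤ Δ^{(∞)}(p′) ≤ a_∞` (`B` = part Ϡ-b's bound on `S_∞`), i.e.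
(4.33)'s uniform coercivity at `K = ∞` (§4).

WHAT THIS FILE PROVES (kernel).  §1 `effLaplacian_transpose_eq`, ★★ **`effLaplacian_apply_eq_fourier`** (every `a, c ≥ 0`, `m² > 0`).  §2 `effLaplacianLim` (★ explicit
`Δ^{(∞)}`), ★★★ **`tendsto_effLaplacian`** (`Δ^{(K)}(b,b′) → Δ^{(∞)}(b,b′)`, `L` odd `≥ 2`, `a, m² > 0`, every unit torus).  §3 ★★★ **`effLaplacianLim_mul_blockCovLim`**
(`Δ^{(∞)}·C^{(∞)} = 1`), `blockCovLim_mul_effLaplacianLim`, ★★ **`blockCovLim_eq_inv`** (`C^{(∞)} = (Δ^{(∞)})⁻¹`), `effLaplacianLim_eq_inv`.  §4 ★★ **`effLaplacianLim_form`**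
(`⟨φ,Δ^{(∞)}φ⟩ = |Ω|⁻¹Σ_q Δ^{(∞)}(p′(q))|φ̃(q)|²`), `effSymLim_le`, `effSymLim_ge`, ★★ **`effLaplacianLim_coercive`** (`⟨φ,Δ^{(∞)}φ⟩ ≥ a_∞∕(1 + a_∞B)·‖φ‖²`),
`effLaplacianLim_form_le` (`≤ a_∞‖φ‖²`).

HONEST SCOPE.  King's `A = 0` model on a finite unit torus; odd `L ≥ 2`, `a, m² > 0`.  The normalisation constants `ln𝒩(Δ^{(K)})` of `S^{(K),1}` (part Τ) are not
tracked here (their convergence is Thm 3.4's (3.93), typed in part Τ-c as a rate); nothing about Bałaban's covariant `Δ^{(k)}(U)`.  N15 untouched; counts unmoved.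
Locators: [King1986] (2.13)–(2.16) p.653, Thm 2.1 (2.22) p.654, Thm 3.4 (3.9) p.656, p.657, (4.5) p.670, (4.22) p.672, (4.33)∕(4.35) p.674.
-/

noncomputable section

open scoped BigOperators ComplexConjugate
open Finset Matrix Filter Topology

namespace Summit.QuantumFields.YangMills.BalabanUVNodes.N15KingModelRung

open Literature.MathematicalPhysics.QuantumFieldTheory.Balaban1983to89.B5Prop11Plancherel (Tor fine chi sOf abs_sOf_le)
open Literature.MathematicalPhysics.QuantumFieldTheory.Balaban1983to89
open Literature.MathematicalPhysics.QuantumFieldTheory.King1986 (aK aK_pos)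
open Literature.MathematicalPhysics.QuantumFieldTheory.King1986.Torus

variable {d : ℕ}

/-! ## §1 The effective Laplacian in plane waves, exactly -/

section Finite

variable (N : ℕ) [NeZero N] (M : Fin d → ℕ) [hM : ∀ μ, NeZero (M μ)]

/-- `Δ_eff` is a symmetric matrix (the tree's `effLaplacian_symm`, as a transpose identity). [cite: King1986, (2.14) p.653] -/
theorem effLaplacian_transpose_eq (a c m2 : ℝ) : (effLaplacian N M a c m2)ᵀ = effLaplacian N M a c m2 := by
  ext x y
  rw [Matrix.transpose_apply]
  exact effLaplacian_symm N M a c m2 x y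

/-- ★★ **THE EFFECTIVE LAPLACIAN IN PLANE WAVES, ENTRYWISE**: `Δ_eff(b, b′) = |Ω|⁻¹ Σ_q effSym(q)·Re e^{iq·(b′ − b)}` (`a, c ≥ 0`, `m² > 0`) — polarization of the
tree's (4.35)∕(4.5) form `effLaplacian_form`. [cite: King1986, (4.5) p.670, (4.35) p.674] -/
theorem effLaplacian_apply_eq_fourier {a c m2 : ℝ} (ha : 0 ≤ a) (hc : 0 ≤ c) (hm : 0 < m2) (b b' : Tor M) :
    effLaplacian N M a c m2 b b' = (Fintype.card (Tor M) : ℝ)⁻¹ * ∑ q : Tor M, effSym N M a c m2 q * (chi M q (b' - b)).re := by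
  have hcM : (Fintype.card (Tor M) : ℝ) ≠ 0 := by exact_mod_cast Fintype.card_ne_zero
  have hform : ∀ φ : Tor M → ℝ, φ ⬝ᵥ (effLaplacian N M a c m2 *ᵥ φ) = (Fintype.card (Tor M) : ℝ)⁻¹ * ∑ q : Tor M, effSym N M a c m2 q * ‖ft M φ q‖ ^ 2 := by
    intro φ
    have h := effLaplacian_form N M ha hc hm φ
    rw [← h]
    field_simp
  have hpol := polarization_entry M _ (effLaplacian_transpose_eq N M a c m2) b b'
  have h1 := hform (Pi.single b 1 + Pi.single b' 1)
  have h2 := hform (Pi.single b 1)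
  have h3 := hform (Pi.single b' 1)
  simp_rw [normSq_ft_single_add] at h1
  simp_rw [normSq_ft_single] at h2 h3
  rw [hpol, h1, h2, h3, ← mul_sub, ← mul_sub, ← Finset.sum_sub_distrib, ← Finset.sum_sub_distrib, mul_div_assoc]
  congr 1
  rw [div_eq_iff two_ne_zero, Finset.sum_mul]
  exact Finset.sum_congr rfl fun q _ => by ring

end Finite

/-! ## §2 The explicit limit `Δ^{(∞)}` -/

section Limit

variable (L : ℕ) (M : Fin (d + 1) → ℕ) [hM : ∀ μ, NeZero (M μ)]

/-- ★ **KING's CONTINUUM UNIT-LATTICE EFFECTIVE LAPLACIAN IN CLOSED FORM**: `Δ^{(∞)}(b, b′) := |Ω|⁻¹ Σ_{q ∈ Ω̂} Δ^{(∞)}(p′(q))·Re e^{iq·(b′ − b)}`, `Δ^{(∞)}(p′) =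
a_∞∕(1 + a_∞S_∞(p′))` (part Ϡ-c's `effSymLim`). [cite: King1986, (2.14) p.653, (4.5) p.670, Thm 3.4 (3.9) p.656] -/
def effLaplacianLim (a m2 : ℝ) (b b' : Tor M) : ℝ :=
  (Fintype.card (Tor M) : ℝ)⁻¹ * ∑ q : Tor M, effSymLim a L m2 (sOf M q) * (chi M q (b' - b)).re

/-- ★★★ **THE EFFECTIVE LAPLACIAN CONVERGES TO `Δ^{(∞)}` IN CLOSED FORM**: for `L` odd, `L ≥ 2`, `a, m² > 0`, every unit torus and all unit sites,
`Δ^{(K)}(b, b′) = effLaplacian (L^K) M a_K L^{2K} m² b b′ → Δ^{(∞)}(b, b′)` as `K → ∞` — Thm 3.4's «two models on the same unit lattice» convergence for the free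
field, with the limit identified. [cite: King1986, Thm 3.4 (3.9) p.656, (2.14) p.653, (4.5) p.670] -/
theorem tendsto_effLaplacian (hLodd : Odd L) (hL : 2 ≤ L) {a m2 : ℝ} (ha : 0 < a) (hm : 0 < m2) (b b' : Tor M) :
    haveI : NeZero L := ⟨by omega⟩
    Tendsto (fun K : ℕ => effLaplacian (L ^ K) M (aK a L K) (((L ^ K : ℕ) : ℝ) ^ 2) m2 b b') atTop (𝓝 (effLaplacianLim L M a m2 b b')) := by
  haveI : NeZero L := ⟨by omega⟩
  have hL1 : (1 : ℝ) < L := by exact_mod_cast (show 1 < L by omega)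
  have hlim : Tendsto (fun K : ℕ => (Fintype.card (Tor M) : ℝ)⁻¹
        * ∑ q : Tor M, effSym (L ^ K) M (aK a L K) (((L ^ K : ℕ) : ℝ) ^ 2) m2 q * (chi M q (b' - b)).re) atTop (𝓝 (effLaplacianLim L M a m2 b b')) := by
    unfold effLaplacianLim
    exact tendsto_const_nhds.mul (tendsto_finsetSum _ fun q _ => (tendsto_effSym_pow L M hLodd hL ha hm q).mul_const _)
  refine hlim.congr' ?_
  filter_upwards [eventually_ge_atTop 1] with K hK
  exact (effLaplacian_apply_eq_fourier (L ^ K) M (aK_pos ha hL1 hK).le (by positivity) hm b b').symm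

/-! ## §3 `Δ^{(∞)}·C^{(∞)} = 1`: the continuum covariance is the inverse of the continuum effective Laplacian -/

/-- ★★★ **`Δ^{(∞)}·C^{(∞)} = 1`** — the finite identities `Δ^{(K)}·(Δ^{(K)})⁻¹ = 1` pass to the `K → ∞` limit entrywise (`L` odd `≥ 2`, `a, m² > 0`, every unit torus).
[cite: King1986, (2.14)–(2.16) p.653, Thm 2.1 (2.22) p.654] -/
theorem effLaplacianLim_mul_blockCovLim (hLodd : Odd L) (hL : 2 ≤ L) {a m2 : ℝ} (ha : 0 < a) (hm : 0 < m2) :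
    (Matrix.of fun b b' => effLaplacianLim L M a m2 b b') * (Matrix.of fun b b' => blockCovLim L M a m2 b b') = 1 := by
  haveI : NeZero L := ⟨by omega⟩
  have hL1 : (1 : ℝ) < L := by exact_mod_cast (show 1 < L by omega)
  ext b b'
  -- the (b,b′) entry of Δ^{(K)}(Δ^{(K)})⁻¹ converges to the (b,b′) entry of Δ^{(∞)}C^{(∞)} and is constantly δ_{bb′}
  have hlim : Tendsto (fun K : ℕ => ∑ x : Tor M, effLaplacian (L ^ K) M (aK a L K) (((L ^ K : ℕ) : ℝ) ^ 2) m2 b x * blockCov L (L ^ K) M a m2 K x b') atTop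
      (𝓝 (∑ x : Tor M, effLaplacianLim L M a m2 b x * blockCovLim L M a m2 x b')) :=
    tendsto_finsetSum _ fun x _ => (tendsto_effLaplacian L M hLodd hL ha hm b x).mul (tendsto_blockCov L M hLodd hL ha hm x b')
  have hconst : ∀ᶠ K : ℕ in atTop, ∑ x : Tor M, effLaplacian (L ^ K) M (aK a L K) (((L ^ K : ℕ) : ℝ) ^ 2) m2 b x * blockCov L (L ^ K) M a m2 K x b'
      = (1 : Matrix (Tor M) (Tor M) ℝ) b b' := by
    filter_upwards [eventually_ge_atTop 1] with K hK
    have hN1 : 1 ≤ L ^ K := Nat.one_le_pow _ _ (by omega)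
    have hunit := effLaplacian_isUnit (L ^ K) M hN1 (aK_pos ha hL1 hK) hm
    have hdet : IsUnit (effLaplacian (L ^ K) M (aK a L K) (((L ^ K : ℕ) : ℝ) ^ 2) m2).det :=
      (Matrix.isUnit_iff_isUnit_det _).mp hunit
    have h := congrFun (congrFun (Matrix.mul_nonsing_inv _ hdet) b) b'
    rw [Matrix.mul_apply] at h
    unfold blockCov
    exact h
  have h1 : Tendsto (fun K : ℕ => ∑ x : Tor M, effLaplacian (L ^ K) M (aK a L K) (((L ^ K : ℕ) : ℝ) ^ 2) m2 b x * blockCov L (L ^ K) M a m2 K x b') atTop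
      (𝓝 ((1 : Matrix (Tor M) (Tor M) ℝ) b b')) :=
    tendsto_const_nhds.congr' (EventuallyEq.symm hconst)
  rw [Matrix.mul_apply]
  simp only [Matrix.of_apply]
  exact tendsto_nhds_unique hlim h1

/-- `C^{(∞)}·Δ^{(∞)} = 1` as well. [cite: King1986, (2.14)–(2.16) p.653] -/
theorem blockCovLim_mul_effLaplacianLim (hLodd : Odd L) (hL : 2 ≤ L) {a m2 : ℝ} (ha : 0 < a) (hm : 0 < m2) :
    (Matrix.of fun b b' => blockCovLim L M a m2 b b') * (Matrix.of fun b b' => effLaplacianLim L M a m2 b b') = 1 :=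
  mul_eq_one_comm.mp (effLaplacianLim_mul_blockCovLim L M hLodd hL ha hm)

/-- ★★ **`C^{(∞)} = (Δ^{(∞)})⁻¹`**: the closed-form limit of NE2's unit-layer kernel is the inverse of King's continuum unit-lattice effective Laplacian.
[cite: King1986, (2.14)–(2.16) p.653, Thm 2.1 (2.22) p.654] -/
theorem blockCovLim_eq_inv (hLodd : Odd L) (hL : 2 ≤ L) {a m2 : ℝ} (ha : 0 < a) (hm : 0 < m2) :
    (Matrix.of fun b b' => blockCovLim L M a m2 b b') = (Matrix.of fun b b' => effLaplacianLim L M a m2 b b')⁻¹ :=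
  (Matrix.inv_eq_right_inv (effLaplacianLim_mul_blockCovLim L M hLodd hL ha hm)).symm

/-- `Δ^{(∞)} = (C^{(∞)})⁻¹`. [cite: King1986, (2.14)–(2.16) p.653] -/
theorem effLaplacianLim_eq_inv (hLodd : Odd L) (hL : 2 ≤ L) {a m2 : ℝ} (ha : 0 < a) (hm : 0 < m2) :
    (Matrix.of fun b b' => effLaplacianLim L M a m2 b b') = (Matrix.of fun b b' => blockCovLim L M a m2 b b')⁻¹ :=
  (Matrix.inv_eq_right_inv (blockCovLim_mul_effLaplacianLim L M hLodd hL ha hm)).symm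

/-! ## §4 The quadratic form of `Δ^{(∞)}` and its uniform coercivity -/

/-- ★★ **THE FORM OF `Δ^{(∞)}`**: `⟨φ, Δ^{(∞)}φ⟩ = |Ω|⁻¹ Σ_q Δ^{(∞)}(p′(q))|φ̃(q)|²` — the limit of the tree's (4.35) form of `Δ^{(K)}`. [cite: King1986, (4.35) p.674, (4.5) p.670] -/
theorem effLaplacianLim_form (hLodd : Odd L) (hL : 2 ≤ L) {a m2 : ℝ} (ha : 0 < a) (hm : 0 < m2) (φ : Tor M → ℝ) :
    φ ⬝ᵥ ((Matrix.of fun b b' => effLaplacianLim L M a m2 b b') *ᵥ φ)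
      = (Fintype.card (Tor M) : ℝ)⁻¹ * ∑ q : Tor M, effSymLim a L m2 (sOf M q) * ‖ft M φ q‖ ^ 2 := by
  haveI : NeZero L := ⟨by omega⟩
  have hL1 : (1 : ℝ) < L := by exact_mod_cast (show 1 < L by omega)
  have hcM : (Fintype.card (Tor M) : ℝ) ≠ 0 := by exact_mod_cast Fintype.card_ne_zero
  have hleft : Tendsto (fun K : ℕ => φ ⬝ᵥ (effLaplacian (L ^ K) M (aK a L K) (((L ^ K : ℕ) : ℝ) ^ 2) m2 *ᵥ φ)) atTop
      (𝓝 (φ ⬝ᵥ ((Matrix.of fun b b' => effLaplacianLim L M a m2 b b') *ᵥ φ))) := by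
    simp only [dotProduct, Matrix.mulVec, Matrix.of_apply]
    exact tendsto_finsetSum _ fun b _ =>
      (tendsto_finsetSum _ fun b' _ => (tendsto_effLaplacian L M hLodd hL ha hm b b').mul_const _).const_mul _
  have hright : Tendsto (fun K : ℕ => (Fintype.card (Tor M) : ℝ)⁻¹
        * ∑ q : Tor M, effSym (L ^ K) M (aK a L K) (((L ^ K : ℕ) : ℝ) ^ 2) m2 q * ‖ft M φ q‖ ^ 2) atTop
      (𝓝 ((Fintype.card (Tor M) : ℝ)⁻¹ * ∑ q : Tor M, effSymLim a L m2 (sOf M q) * ‖ft M φ q‖ ^ 2)) :=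
    tendsto_const_nhds.mul (tendsto_finsetSum _ fun q _ => (tendsto_effSym_pow L M hLodd hL ha hm q).mul_const _)
  have heq : (fun K : ℕ => φ ⬝ᵥ (effLaplacian (L ^ K) M (aK a L K) (((L ^ K : ℕ) : ℝ) ^ 2) m2 *ᵥ φ))
      =ᶠ[atTop] (fun K : ℕ => (Fintype.card (Tor M) : ℝ)⁻¹
        * ∑ q : Tor M, effSym (L ^ K) M (aK a L K) (((L ^ K : ℕ) : ℝ) ^ 2) m2 q * ‖ft M φ q‖ ^ 2) := by
    filter_upwards [eventually_ge_atTop 1] with K hK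
    have h := effLaplacian_form (L ^ K) M (c := ((L ^ K : ℕ) : ℝ) ^ 2) (aK_pos ha hL1 hK).le (by positivity) hm φ
    rw [← h]
    field_simp
  exact tendsto_nhds_unique (hleft.congr' heq) hright

omit hM in
/-- `Δ^{(∞)}(p′) ≤ a_∞` (`S_∞ ≥ 0`). [cite: King1986, (4.5) p.670] -/
theorem effSymLim_le {a Lr m2 : ℝ} (ha : 0 < a) (hL : 1 < Lr) (hm : 0 ≤ m2) (p : Fin (d + 1) → ℝ) : effSymLim a Lr m2 p ≤ aInf a Lr := by
  unfold effSymLim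
  have h1 := aInf_pos ha hL
  have h2 := aliasSeries0_nonneg (d := d + 1) hm p
  rw [div_le_iff₀ (by positivity), mul_add, mul_one]
  have h3 : 0 ≤ aInf a Lr * (aInf a Lr * aliasSeries0 m2 p) := by positivity
  linarith

omit hM in
/-- `Δ^{(∞)}(p′) ≥ a_∞∕(1 + a_∞B)`, `B = (π∕2)^{2(d+1)}π^{d+1}(1 + 4∕π)^{d+1}∕m²` (part Ϡ-b's bound `S_∞ ≤ B`, `|p′_μ| ≤ π`). [cite: King1986, (4.5) p.670, (4.22) p.672, (4.33) p.674] -/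
theorem effSymLim_ge {a Lr m2 : ℝ} (ha : 0 < a) (hL : 1 < Lr) (hm : 0 < m2) {p : Fin (d + 1) → ℝ} (hp : ∀ μ, |p μ| ≤ Real.pi) :
    aInf a Lr / (1 + aInf a Lr * ((Real.pi / 2) ^ (2 * (d + 1)) * Real.pi ^ (d + 1) / m2 * (1 + 4 / Real.pi) ^ (d + 1)))
      ≤ effSymLim a Lr m2 p := by
  unfold effSymLim
  have h1 := aInf_pos ha hL
  have h2 := aliasSeries0_nonneg (d := d + 1) hm.le p
  have h3 := aliasSeries0_le (d := d + 1) hm hp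
  exact div_le_div_of_nonneg_left h1.le (by positivity) (by nlinarith)

/-- ★★ **UNIFORM COERCIVITY OF `Δ^{(∞)}`** ((4.33)'s shape at `K = ∞`): `⟨φ, Δ^{(∞)}φ⟩ ≥ a_∞∕(1 + a_∞B)·‖φ‖²` for every real `φ` on every unit torus.
[cite: King1986, (4.33) p.674, (4.5) p.670] -/
theorem effLaplacianLim_coercive (hLodd : Odd L) (hL : 2 ≤ L) {a m2 : ℝ} (ha : 0 < a) (hm : 0 < m2) (φ : Tor M → ℝ) :
    aInf a L / (1 + aInf a L * ((Real.pi / 2) ^ (2 * (d + 1)) * Real.pi ^ (d + 1) / m2 * (1 + 4 / Real.pi) ^ (d + 1))) * (φ ⬝ᵥ φ)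
      ≤ φ ⬝ᵥ ((Matrix.of fun b b' => effLaplacianLim L M a m2 b b') *ᵥ φ) := by
  have hL1 : (1 : ℝ) < L := by exact_mod_cast (show 1 < L by omega)
  rw [effLaplacianLim_form L M hLodd hL ha hm φ]
  set γ := aInf a L / (1 + aInf a L * ((Real.pi / 2) ^ (2 * (d + 1)) * Real.pi ^ (d + 1) / m2 * (1 + 4 / Real.pi) ^ (d + 1))) with hγ
  have hS : ∀ q : Tor M, γ * ‖ft M φ q‖ ^ 2 ≤ effSymLim a L m2 (sOf M q) * ‖ft M φ q‖ ^ 2 := fun q =>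
    mul_le_mul_of_nonneg_right (effSymLim_ge ha hL1 hm (abs_sOf_le M q)) (sq_nonneg _)
  have hsum : γ * ∑ q : Tor M, ‖ft M φ q‖ ^ 2 ≤ ∑ q : Tor M, effSymLim a L m2 (sOf M q) * ‖ft M φ q‖ ^ 2 := by
    rw [Finset.mul_sum]
    exact Finset.sum_le_sum fun q _ => hS q
  have hpars : ∑ q : Tor M, ‖ft M φ q‖ ^ 2 = (Fintype.card (Tor M) : ℝ) * (φ ⬝ᵥ φ) := (parseval_dot M φ).symm
  have hcM : (0 : ℝ) < Fintype.card (Tor M) := by exact_mod_cast Fintype.card_pos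
  calc γ * (φ ⬝ᵥ φ) = (Fintype.card (Tor M) : ℝ)⁻¹ * (γ * ∑ q : Tor M, ‖ft M φ q‖ ^ 2) := by rw [hpars]; field_simp
    _ ≤ (Fintype.card (Tor M) : ℝ)⁻¹ * ∑ q : Tor M, effSymLim a L m2 (sOf M q) * ‖ft M φ q‖ ^ 2 := mul_le_mul_of_nonneg_left hsum (by positivity)

/-- `⟨φ, Δ^{(∞)}φ⟩ ≤ a_∞‖φ‖²`. [cite: King1986, (4.5) p.670, (4.35) p.674] -/
theorem effLaplacianLim_form_le (hLodd : Odd L) (hL : 2 ≤ L) {a m2 : ℝ} (ha : 0 < a) (hm : 0 < m2) (φ : Tor M → ℝ) :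
    φ ⬝ᵥ ((Matrix.of fun b b' => effLaplacianLim L M a m2 b b') *ᵥ φ) ≤ aInf a L * (φ ⬝ᵥ φ) := by
  have hL1 : (1 : ℝ) < L := by exact_mod_cast (show 1 < L by omega)
  rw [effLaplacianLim_form L M hLodd hL ha hm φ]
  have hS : ∀ q : Tor M, effSymLim a L m2 (sOf M q) * ‖ft M φ q‖ ^ 2 ≤ aInf a L * ‖ft M φ q‖ ^ 2 := fun q =>
    mul_le_mul_of_nonneg_right (effSymLim_le ha hL1 hm.le (sOf M q)) (sq_nonneg _)
  have hsum : ∑ q : Tor M, effSymLim a L m2 (sOf M q) * ‖ft M φ q‖ ^ 2 ≤ aInf a L * ∑ q : Tor M, ‖ft M φ q‖ ^ 2 := by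
    rw [Finset.mul_sum]
    exact Finset.sum_le_sum fun q _ => hS q
  have hpars : ∑ q : Tor M, ‖ft M φ q‖ ^ 2 = (Fintype.card (Tor M) : ℝ) * (φ ⬝ᵥ φ) := (parseval_dot M φ).symm
  have hcM : (0 : ℝ) < Fintype.card (Tor M) := by exact_mod_cast Fintype.card_pos
  calc (Fintype.card (Tor M) : ℝ)⁻¹ * ∑ q : Tor M, effSymLim a L m2 (sOf M q) * ‖ft M φ q‖ ^ 2
      ≤ (Fintype.card (Tor M) : ℝ)⁻¹ * (aInf a L * ∑ q : Tor M, ‖ft M φ q‖ ^ 2) := mul_le_mul_of_nonneg_left hsum (by positivity)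
    _ = aInf a L * (φ ⬝ᵥ φ) := by rw [hpars]; field_simp

end Limit

end Summit.QuantumFields.YangMills.BalabanUVNodes.N15KingModelRung

end
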